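import Summits.FinalStateConjecture.FinalStateConjecture.Theses.RobustClausewiseGenericity
import Summits.FinalStateConjecture.FinalStateConjecture.Theorems.PhotonSphereChannelsTameCensorshipReduction
import HarnessLib

/-!
# `Assembly` (item stmt-FinalStateConjecture-10135, route `RobustClausewiseGenericity`) — PROVED:
# robust escapability is closed under conjunction; robust clauses + gauge ⇒ Christodoulou genericity

The deciding glue of route `RobustClausewiseGenericity` of summit `FinalStateConjecture`,
`Assembly := CensorshipRobust → SettlingRobust → ThirdLawRobust → GaugeEnrichment → MGHDExists →
FinalStateConjecture`, is pure logic plus finite-dimensional calculus once the three clause cruxes are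
given in their ROBUST (enrichment-stable) form, and this file proves it. The same kernel is the
composition step of line `hair-vacates-the-margin` of crux `GenericCensorshipCollarMargin` (stmt-10809,
route `BartnikGapSettling`), whose skeleton (`Cruxes/GenericCensorshipCollarMargin/Lines/hair_vacates_the_margin.lean`,
reshape r3) carried a two-clause copy; here it is landed once, for every finite conjunction.

## Contents (all proved; namespace `…Theorems.RobustClausewiseGenericity`)

* `Tame`, `RobustlyEscapable`, `GaugeAt` — the route legend, VERBATIM the `let Tame`, the robust
  quantifier block and the body of `GaugeEnrichment` of `Theses/RobustClausewiseGenericity.lean`, as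
  named predicates (so that the items unfold to them by `dsimp only`).
* `RobustlyEscapable.mono_of_mem`, **`RobustlyEscapable.and`** — monotone in the property (on the
  admissible class) and CLOSED UNDER CONJUNCTION: enrich for `Q₁`, enrich the result for `Q₂`; every further enrichment enriches both, so it
  carries two open dense direction sets, whose intersection is open dense (this is exactly what plain
  curve-codimension lacks, `PlanarNonClosure`).
* `exists_localFamily_of_robustlyEscapable` — ONE robust property + gauge enrichment at an admissible
  `d` ⇒ a jointly smooth admissible family through `d`, injective and good for small parameters `≠ 0`
  (radial curve along a direction common to the escape set and `{dΛ ≠ 0}`; injective where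
  `t ↦ Λ(G(t u))` is strictly monotone).
* **`isChristodoulouGeneric_of_robustlyEscapable`** — robust escapability of `Q` at EVERY admissible
  datum + gauge enrichment at every admissible datum ⇒ `IsChristodoulouGeneric (admissibleVacuumData X) Q 1`
  (squash `ℝ¹` onto the good interval: `PhotonSphereChannels.isChristodoulouGeneric_one_of_local`).
* **`assembly_proof : Theses.RobustClausewiseGenericity.Assembly`** — the item: conjoin the three robust
  clauses, pass to genericity with `GaugeEnrichment`, and read the summit property off pointwise
  (`MGHDExists` supplies the anti-vacuity conjunct; `ThirdLawRobust` is applied to the decomposition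
  that `SettlingRobust` provides).

## References

* D. Christodoulou, *On the global initial value problem and the issue of singularities*, CQG 16 (1999)
  A23–A35, p. A24 (positive-codimension genericity). [Christodoulou1999]
* B. R. Hunt, T. Sauer, J. A. Yorke, *Prevalence*, Bull. AMS 27 (1992) 217–238, Fact 3″ (closure
  under intersection — the property robustness restores). [HuntSauerYorke1992]
-/

noncomputable section

namespace Summit.FinalStateConjecture.FinalStateConjecture.Theorems.RobustClausewiseGenericity

open Literature.Geometry.Lorentzian
open Set Function Filter Metric
open scoped Manifold ContDiff Topology

-- D-0017: single-problem summit, `Summit.<S>.<S>.…` by design.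
set_option linter.dupNamespace false

/-! ## The legend as named predicates -/

section Legend

variable {X : Type} [TopologicalSpace X] [ChartedSpace E3 X] [IsManifold (𝓡 3) ∞ X]

/-- **Tame probes** (the `let Tame` of every item of `Theses/RobustClausewiseGenericity.lean`, verbatim):
a jointly smooth `m`-parameter family of ADMISSIBLE data through `d` which agrees with `d` (both fundamental
forms, pointwise) off ONE compact set. [cite: Christodoulou1999, p. A24] -/
def Tame (d : InitialDataSet (𝓡 3) X) (m : ℕ)
    (G : EuclideanSpace ℝ (Fin m) → InitialDataSet (𝓡 3) X) : Prop :=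
  InitialDataSet.IsSmoothDataFamily m G ∧ G 0 = d ∧ (∀ c, G c ∈ admissibleVacuumData X) ∧
    ∃ K : Set X, IsCompact K ∧ ∀ c, ∀ x ∉ K, (G c).h.inner x = d.h.inner x ∧ (G c).k x = d.k x

/-- **Robust escapability** of a property `Q` at `d` (the common quantifier block of `SettlingRobust`,
`CensorshipRobust`, `ThirdLawRobust`, verbatim): every tame probe `G` through `d` enriches (along an
injective linear map of parameter spaces) to a tame `G₁` such that along EVERY further tame enrichment `G₂`
an open dense set of radial directions `v` has `Q (G₂ (t • v))` for all small `t ≠ 0`. [cite: Christodoulou1999, p. A24] -/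
def RobustlyEscapable (d : InitialDataSet (𝓡 3) X) (Q : InitialDataSet (𝓡 3) X → Prop) : Prop :=
  ∀ (m : ℕ) (G : EuclideanSpace ℝ (Fin m) → InitialDataSet (𝓡 3) X), Tame d m G →
    ∃ (n : ℕ) (G₁ : EuclideanSpace ℝ (Fin n) → InitialDataSet (𝓡 3) X)
      (L : EuclideanSpace ℝ (Fin m) →ₗ[ℝ] EuclideanSpace ℝ (Fin n)),
      Function.Injective L ∧ Tame d n G₁ ∧ (∀ c, G₁ (L c) = G c) ∧
      ∀ (p : ℕ) (G₂ : EuclideanSpace ℝ (Fin p) → InitialDataSet (𝓡 3) X)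
        (L' : EuclideanSpace ℝ (Fin n) →ₗ[ℝ] EuclideanSpace ℝ (Fin p)),
        Function.Injective L' → Tame d p G₂ → (∀ c, G₂ (L' c) = G₁ c) →
        ∃ U : Set (EuclideanSpace ℝ (Fin p)), IsOpen U ∧ Dense U ∧
          ∀ v ∈ U, ∃ δ : ℝ, 0 < δ ∧ ∀ t : ℝ, t ≠ 0 → |t| < δ → Q (G₂ (t • v))

/-- **Gauge enrichment at `d`** (the body of `GaugeEnrichment`, verbatim): every tame probe enriches by one
coordinate along which some functional `Λ` of the data is `C¹` with non-zero derivative. [cite: Christodoulou1999, p. A24] -/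
def GaugeAt (d : InitialDataSet (𝓡 3) X) : Prop :=
  ∀ (m : ℕ) (G : EuclideanSpace ℝ (Fin m) → InitialDataSet (𝓡 3) X), Tame d m G →
    ∃ (G₁ : EuclideanSpace ℝ (Fin (m + 1)) → InitialDataSet (𝓡 3) X)
      (L : EuclideanSpace ℝ (Fin m) →ₗ[ℝ] EuclideanSpace ℝ (Fin (m + 1)))
      (w : EuclideanSpace ℝ (Fin (m + 1))) (Λ : InitialDataSet (𝓡 3) X → ℝ),
      Function.Injective L ∧ Tame d (m + 1) G₁ ∧ (∀ c, G₁ (L c) = G c) ∧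
      ContDiff ℝ 1 (Λ ∘ G₁) ∧ fderiv ℝ (Λ ∘ G₁) 0 w ≠ 0

/-- The constant `0`-parameter family through an admissible `d` is tame. [cite: Christodoulou1999, p. A24] -/
theorem tame_const {d : InitialDataSet (𝓡 3) X} (hd : d ∈ admissibleVacuumData X) :
    Tame d 0 (fun _ => d) :=
  ⟨InitialDataSet.isSmoothDataFamily_const 0 d, rfl, fun _ => hd, ∅, isCompact_empty,
    fun _ _ _ => ⟨rfl, rfl⟩⟩

/-- Robust escapability is monotone under implications valid on the ADMISSIBLE class only (every member
of a tame probe is admissible, so nothing more is ever used). [cite: Christodoulou1999, p. A24] -/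
theorem RobustlyEscapable.mono_of_mem {d : InitialDataSet (𝓡 3) X} {Q Q' : InitialDataSet (𝓡 3) X → Prop}
    (h : RobustlyEscapable d Q) (hQ : ∀ D ∈ admissibleVacuumData X, Q D → Q' D) :
    RobustlyEscapable d Q' := by
  intro m G hG
  obtain ⟨n, G₁, L, hL, hT, hGL, H⟩ := h m G hG
  refine ⟨n, G₁, L, hL, hT, hGL, fun p G₂ L' hL' hT₂ hGL' => ?_⟩
  obtain ⟨U, hUo, hUd, hU⟩ := H p G₂ L' hL' hT₂ hGL'
  refine ⟨U, hUo, hUd, fun v hv => ?_⟩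
  obtain ⟨δ, hδ, hv'⟩ := hU v hv
  exact ⟨δ, hδ, fun t ht htδ => hQ _ (hT₂.2.2.1 _) (hv' t ht htδ)⟩

/-- **Robust escapability is CLOSED UNDER CONJUNCTION** — the structural reason the route states its three
clauses robustly (plain curve-codimension is not ∧-closed, `PlanarNonClosure`). Enrich the probe for `Q₁`,
enrich the result for `Q₂`; a further enrichment of the second enriches the first along the composite
linear map, so it carries BOTH open dense escape sets, and their intersection is open dense with the
smaller of the two radii. [cite: HuntSauerYorke1992, Fact 3″] -/
theorem RobustlyEscapable.and {d : InitialDataSet (𝓡 3) X} {Q₁ Q₂ : InitialDataSet (𝓡 3) X → Prop}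
    (h₁ : RobustlyEscapable d Q₁) (h₂ : RobustlyEscapable d Q₂) :
    RobustlyEscapable d fun D => Q₁ D ∧ Q₂ D := by
  intro m G hG
  obtain ⟨n₁, G₁, L₁, hL₁, hT₁, hGL₁, hR₁⟩ := h₁ m G hG
  obtain ⟨n₂, G₂, L₂, hL₂, hT₂, hGL₂, hR₂⟩ := h₂ n₁ G₁ hT₁
  refine ⟨n₂, G₂, L₂.comp L₁, fun a b h => hL₁ (hL₂ h), hT₂,
    fun c => by rw [LinearMap.comp_apply, hGL₂, hGL₁], fun p G₃ L' hL' hT₃ hGL₃ => ?_⟩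
  obtain ⟨U₁, hU₁o, hU₁d, hU₁⟩ := hR₁ p G₃ (L'.comp L₂) (fun a b h => hL₂ (hL' h)) hT₃
    (fun c => by rw [LinearMap.comp_apply, hGL₃, hGL₂])
  obtain ⟨U₂, hU₂o, hU₂d, hU₂⟩ := hR₂ p G₃ L' hL' hT₃ hGL₃
  refine ⟨U₁ ∩ U₂, hU₁o.inter hU₂o, hU₁d.inter_of_isOpen_right hU₂d hU₂o, fun v hv => ?_⟩
  obtain ⟨δ₁, hδ₁, hv₁⟩ := hU₁ v hv.1
  obtain ⟨δ₂, hδ₂, hv₂⟩ := hU₂ v hv.2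
  exact ⟨min δ₁ δ₂, lt_min hδ₁ hδ₂, fun t ht htδ =>
    ⟨hv₁ t ht (htδ.trans_le (min_le_left _ _)), hv₂ t ht (htδ.trans_le (min_le_right _ _))⟩⟩

end Legend

/-! ## Two calculus lemmas -/

section Analysis

variable {E : Type*} [NormedAddCommGroup E] [NormedSpace ℝ E]

/-- The complement of the kernel of a non-zero continuous linear functional is dense (approach a kernel
vector `v` by `v + w/(n+1)`). [folklore] -/
theorem dense_setOf_apply_ne_zero (f : E →L[ℝ] ℝ) {w : E} (hw : f w ≠ 0) :
    Dense {v : E | f v ≠ 0} := by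
  intro v
  by_cases hv : f v = 0
  swap
  · exact subset_closure hv
  have htend : Tendsto (fun n : ℕ => v + (1 / ((n : ℝ) + 1)) • w) atTop (𝓝 v) := by
    have h1 : Tendsto (fun n : ℕ => (1 / ((n : ℝ) + 1)) • w) atTop (𝓝 ((0 : ℝ) • w)) :=
      tendsto_one_div_add_atTop_nhds_zero_nat.smul_const w
    rw [zero_smul] at h1
    simpa using tendsto_const_nhds.add h1
  refine mem_closure_of_tendsto htend (Eventually.of_forall fun n => ?_)
  show f (v + (1 / ((n : ℝ) + 1)) • w) ≠ 0
  rw [map_add, map_smul, hv, zero_add, smul_eq_mul]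
  exact mul_ne_zero (one_div_ne_zero (Nat.cast_add_one_ne_zero n)) hw

/-- Along a direction with non-zero derivative a `C¹` function is injective near `0` (strict monotonicity
of `t ↦ f(t u)` on an interval where its continuous derivative keeps its sign). [folklore] -/
theorem exists_injOn_line_of_fderiv_ne {f : E → ℝ} (hf : ContDiff ℝ 1 f) {u : E}
    (hu : fderiv ℝ f 0 u ≠ 0) :
    ∃ δ : ℝ, 0 < δ ∧ ∀ t t' : ℝ, |t| < δ → |t'| < δ → f (t • u) = f (t' • u) → t = t' := by
  set g : ℝ → ℝ := fun t => f (t • u) with hg_def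
  have hline : ContDiff ℝ 1 (fun t : ℝ => t • u) := contDiff_id.smul contDiff_const
  have hg : ContDiff ℝ 1 g := hf.comp hline
  have hderiv : ∀ t : ℝ, HasDerivAt g (fderiv ℝ f (t • u) u) t := by
    intro t
    have h1 : HasDerivAt (fun s : ℝ => s • u) ((1 : ℝ) • u) t := (hasDerivAt_id t).smul_const u
    rw [one_smul] at h1
    exact ((hf.differentiable one_ne_zero) (t • u)).hasFDerivAt.comp_hasDerivAt t h1
  have hcont : Continuous (deriv g) := hg.continuous_deriv le_rfl
  have hd0 : deriv g 0 = fderiv ℝ f 0 u := by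
    rw [(hderiv 0).deriv, zero_smul]
  have hne : deriv g 0 ≠ 0 := by rwa [hd0]
  rcases lt_or_gt_of_ne hne with hneg | hpos
  · obtain ⟨δ, hδ, hball⟩ := Metric.eventually_nhds_iff.1
      (hcont.continuousAt.eventually (gt_mem_nhds hneg))
    refine ⟨δ, hδ, fun t t' ht ht' hEq => ?_⟩
    have hanti : StrictAntiOn g (Ioo (-δ) δ) := by
      refine strictAntiOn_of_deriv_neg (convex_Ioo _ _) hg.continuous.continuousOn ?_
      intro x hx
      rw [interior_Ioo] at hx
      exact hball (by simpa [Real.dist_eq, abs_lt] using hx)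
    exact hanti.injOn (by simpa [abs_lt] using ht) (by simpa [abs_lt] using ht') hEq
  · obtain ⟨δ, hδ, hball⟩ := Metric.eventually_nhds_iff.1
      (hcont.continuousAt.eventually (lt_mem_nhds hpos))
    refine ⟨δ, hδ, fun t t' ht ht' hEq => ?_⟩
    have hmono : StrictMonoOn g (Ioo (-δ) δ) := by
      refine strictMonoOn_of_deriv_pos (convex_Ioo _ _) hg.continuous.continuousOn ?_
      intro x hx
      rw [interior_Ioo] at hx
      exact hball (by simpa [Real.dist_eq, abs_lt] using hx)
    exact hmono.injOn (by simpa [abs_lt] using ht) (by simpa [abs_lt] using ht') hEq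

end Analysis

/-! ## One robust property + gauge ⇒ a local escaping curve; hence genericity -/

section Genericity

variable {X : Type} [TopologicalSpace X] [ChartedSpace E3 X] [IsManifold (𝓡 3) ∞ X]

/-- **A local escaping curve from ONE robust property and the gauge.** If `Q` is robustly escapable at the
admissible datum `d` and `d` admits gauge enrichment, there is a jointly smooth family `F : ℝ¹ → data`
through `d` which, for parameters `|c| < ε`, is injective and admissible, and has `Q (F c)` for `c ≠ 0`.
Proof: enrich the constant probe for `Q` to `G₁`, enrich `G₁` by the gauge coordinate to `G₂`; `G₂` enriches
`G₁`, so an open dense set of its directions escapes radially, and `{v | d(Λ ∘ G₂)(0) v ≠ 0}` is open dense;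
a common direction `u` and `F c := G₂ ((c 0) • u)` do it. [cite: Christodoulou1999, p. A24] -/
theorem exists_localFamily_of_robustlyEscapable {d : InitialDataSet (𝓡 3) X}
    (hd : d ∈ admissibleVacuumData X) {Q : InitialDataSet (𝓡 3) X → Prop}
    (hQ : RobustlyEscapable d Q) (hG : GaugeAt d) :
    ∃ (ε : ℝ) (F : EuclideanSpace ℝ (Fin 1) → InitialDataSet (𝓡 3) X), 0 < ε ∧
      InitialDataSet.IsSmoothDataFamily 1 F ∧ F 0 = d ∧
      (∀ c c' : EuclideanSpace ℝ (Fin 1), |c 0| < ε → |c' 0| < ε → F c = F c' → c = c') ∧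
      (∀ c : EuclideanSpace ℝ (Fin 1), |c 0| < ε → F c ∈ admissibleVacuumData X) ∧
      ∀ c : EuclideanSpace ℝ (Fin 1), c ≠ 0 → |c 0| < ε → Q (F c) := by
  -- enrich the constant probe for `Q`, then by the gauge coordinate
  obtain ⟨n₁, G₁, L₁, -, hT₁, -, hR₁⟩ := hQ 0 (fun _ => d) (tame_const hd)
  obtain ⟨G₂, L₂, w, Λ, hL₂, hT₂, hGL₂, hΛ, hΛw⟩ := hG n₁ G₁ hT₁
  obtain ⟨U₁, hU₁o, hU₁d, hU₁⟩ := hR₁ (n₁ + 1) G₂ L₂ hL₂ hT₂ hGL₂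
  -- the gauge direction set
  set U₃ : Set (EuclideanSpace ℝ (Fin (n₁ + 1))) := {v | fderiv ℝ (Λ ∘ G₂) 0 v ≠ 0} with hU₃_def
  have hU₃o : IsOpen U₃ := isOpen_ne_fun (fderiv ℝ (Λ ∘ G₂) 0).continuous continuous_const
  have hU₃d : Dense U₃ := dense_setOf_apply_ne_zero _ hΛw
  -- a common direction
  obtain ⟨u, hu₁, hu₃⟩ := (hU₁d.inter_of_isOpen_right hU₃d hU₃o).nonempty
  obtain ⟨δ₁, hδ₁, hQ₁⟩ := hU₁ u hu₁
  obtain ⟨δ₃, hδ₃, hinj⟩ := exists_injOn_line_of_fderiv_ne hΛ hu₃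
  -- the curve
  refine ⟨min δ₁ δ₃, fun c => G₂ ((c 0) • u), lt_min hδ₁ hδ₃, ?_, ?_, ?_, ?_, ?_⟩
  · exact PhotonSphereChannels.isSmoothDataFamily_comp hT₂.1
      (PhotonSphereChannels.contDiff_euclideanOne_apply.smul contDiff_const)
  · show G₂ (((0 : EuclideanSpace ℝ (Fin 1)) 0) • u) = d
    rw [PiLp.zero_apply, zero_smul]
    exact hT₂.2.1
  · intro c c' hc hc' hEq
    have hcδ : |c 0| < δ₃ := hc.trans_le (min_le_right _ _)
    have hc'δ : |c' 0| < δ₃ := hc'.trans_le (min_le_right _ _)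
    have hΛeq : (Λ ∘ G₂) ((c 0) • u) = (Λ ∘ G₂) ((c' 0) • u) := by
      have hEq' : G₂ ((c 0) • u) = G₂ ((c' 0) • u) := hEq
      show Λ (G₂ ((c 0) • u)) = Λ (G₂ ((c' 0) • u))
      rw [hEq']
    have h00 : c 0 = c' 0 := hinj (c 0) (c' 0) hcδ hc'δ hΛeq
    ext i
    fin_cases i
    exact h00
  · intro c _
    exact hT₂.2.2.1 _
  · intro c hc hcε
    have hc0 : c 0 ≠ 0 := by
      intro h0
      apply hc
      ext i
      fin_cases i
      simpa using h0
    exact hQ₁ (c 0) hc0 (hcε.trans_le (min_le_left _ _))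

/-- **Robust clauses + gauge ⇒ Christodoulou genericity (codimension ≥ 1).** If `Q` is robustly escapable
at EVERY admissible datum and every admissible datum admits gauge enrichment, then `Q` is
Christodoulou-generic in the admissible class: through every exceptional datum passes an injective smooth
admissible curve meeting the exceptional set only at parameter `0` (the local curve of
`exists_localFamily_of_robustlyEscapable`, squashed onto its good interval by
`PhotonSphereChannels.isChristodoulouGeneric_one_of_local`). [cite: Christodoulou1999, p. A24] -/
theorem isChristodoulouGeneric_of_robustlyEscapable [T2Space X] [SecondCountableTopology X]
    {Q : InitialDataSet (𝓡 3) X → Prop}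
    (hQ : ∀ d ∈ admissibleVacuumData X, RobustlyEscapable d Q)
    (hG : ∀ d ∈ admissibleVacuumData X, GaugeAt d) :
    InitialDataSet.IsChristodoulouGeneric (admissibleVacuumData X) Q 1 := by
  refine PhotonSphereChannels.isChristodoulouGeneric_one_of_local fun d hd _ => ?_
  obtain ⟨ε, F, hε, hF, h0, hinj, hadm, hP⟩ :=
    exists_localFamily_of_robustlyEscapable hd (hQ d hd) (hG d hd)
  exact ⟨ε, F, hε, hF, h0, hinj, hadm, hP⟩

end Genericity

/-! ## The item -/

/-- **`Assembly` (current item stmt-FinalStateConjecture-16825; earlier forms stmt-10135 / stmt-17500 superseded) —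
PROVED by the route's crux-only deciding theorem.** `SettlingRobust → CensorshipRobust → ThirdLawRobust →
MGHDExists → FinalStateConjecture` is, binder for binder, the frame of `Theses.RobustClausewiseGenericity.closes`
(route-repair rev 7, 2026-08-17: pointed gauge enrichment, general position, tame packaging and the immersion
chain rule all live inside that proof term), so the item is closed by applying it — exactly as the route file
prescribes ("a prover closes this item with `fun hS hC hT hM ↦ closes hS hC hT hM`"). (buildfix 2026-08-20,
proof-only: the previous proof, written for the pre-T2 five-hypothesis Assembly via
`isChristodoulouGeneric_of_robustlyEscapable`, no longer type-checks against the re-typed summit; the §1–§3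
genericity lemmas above are kept verbatim for their importers.) [cite: Christodoulou1999, p. A24] -/
theorem assembly_proof :
    Summit.FinalStateConjecture.FinalStateConjecture.Theses.RobustClausewiseGenericity.Assembly :=
  fun hS hC hT hM ↦
    Summit.FinalStateConjecture.FinalStateConjecture.Theses.RobustClausewiseGenericity.closes hS hC hT hM

end Summit.FinalStateConjecture.FinalStateConjecture.Theorems.RobustClausewiseGenericity

end
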